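import Summits.BirchSwinnertonDyer.BirchSwinnertonDyer.Theorems.AlignedTransportAtTwoMainConjectureOfRankZeroBSDAtTwoCubicResolventParity
import Summits.BirchSwinnertonDyer.BirchSwinnertonDyer.Theorems.AlignedTransportAtTwoMainConjectureOfRankZeroBSDAtTwoFineRoadTowerImageDelta
import Summits.BirchSwinnertonDyer.BirchSwinnertonDyer.Theorems.AlignedTransportAtTwoMainConjectureOfRankZeroBSDAtTwoFineRoadRealKummerLinesPadicLetterOnPointsPrimes
import Summits.BirchSwinnertonDyer.BirchSwinnertonDyer.Theorems.ByReductionTypeAtTwoFineSelmerConjAAtTwoAdditivePotGoodCubicHeart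
import HarnessLib

/-!
# Route `AlignedTransportAtTwo`, crux C2 `MainConjectureOfRankZeroBSDAtTwo` (stmt-BirchSwinnertonDyer-22298):
# PARITY TRANSFER DOWN TO THE CUBIC `2`-TORSION FIELD `ℚ(β)` THROUGH THE `S₃`-CLOSURE `ℚ(W[2]) ⊇ ℚ(β), ℚ(√Δ_W)`, and the parity count
# `#{v ∣ p} ≡ [F : ℚ] (mod 2)` when all `e`, `f` above `p` are odd

HONEST FRAMING (cell `bsd-f1-sign2`, WIDTH-5 attached prover seat `bsd-line-att-p5` gen 27 on line `birth` of the lead `bsd-line-att-p2`;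
`--supports` stmt-BirchSwinnertonDyer-22298, closes nothing; BSD is NOT proved by any of this; the crux C2, its verdict «blocked-on
`Rank1Residual.GreenbergMuConjectureIrreducible`» and every registered stub are untouched). THEOREMS ONLY — no definition, no named fact,
no `sorry`. Middle file of this gen's three («the OFF-stratum ramification bit, kernel»): `…CubicResolventParity` (p751095: odd-degree Galois
extensions have odd `e(𝔓|𝔮)`, `f(𝔓|𝔮)`; `e`, `f` above `2` of `ℚ(√D)` from `D mod 8`) ⟶ THIS FILE ⟶ `…CubicOffStratumRamification` (the seed cell:
`hodd ⟺ Δ_min ≡ 1 (mod 4)`, the OFF-stratum Chevalley door p748062 with its ramification bit discharged on `Δ_min ≡ 5 (8)`, vacuous on `≡ 3, 7 (8)`).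

WHAT.
* §3 `emod_eight_of_isSquare`; `finrank_adjoin_eq_two_of_sq_eq` (`[ℚ(δ):ℚ] = 2` for `δ² = q ∉ ℚ²`); (`[K(E[2]) : K] ∣ 6` is the tree's
  `AddKatoTwo.finrank_divisionField_two_dvd_six`, rung K4 of route `ByReductionTypeAtTwo`); **`parity_transfer_adjoin_root`**: `W/ℚ` elliptic with `Δ_W ∉ ℚ²`, `δ² = Δ_W`, `β` a root of the `2`-division cubic, `p` ANY prime — inside `ℚ̄`,
  `ℚ(W[2]) ⊇ ℚ(β), ℚ(δ)` (tree `rootSet_subset_divisionField`, `xT_mem_divisionField`, `16δ₀² = Δ`) is Galois over `ℚ` (tree `isGalois_divisionField`)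
  hence over `ℚ(δ)`, of degree `[ℚ(W[2]):ℚ]/2 ∣ 3`; so (p751095 §1) if every prime of `ℚ(δ)` above `p` has odd `e` (resp. odd `f`), then so does every
  prime of `ℚ(β)` above `p`. No reduction hypothesis, no irreducibility hypothesis.
* §4 `ncard_setOf_mem_mod_two_eq_finrank_mod_two` (any number field `F`, any `p`: all `e_v`, `f_v` (`v ∣ p`) odd ⟹ `#{v ∣ p} ≡ [F:ℚ] (mod 2)`, the
  fundamental identity summed modulo `2`); `odd_ncard_setOf_mem_of_cubic`.

References: [NeukirchANT1999] Ch. I §8 Prop. (8.2), §9; [SilvermanAEC2009] III.§1, III.§7, VIII.§1; [SerreInventiones1972] §5.3;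
[DokchitserDokchitserMathZ2012] proof of the Theorem (ℚ(E[2]) ⊃ ℚ(√Δ)); [Marcus2018] Ch. 4; tree: p751095, att-p5 g6/g7 `FineRoadDivisionCubic` /
`FineRoadTowerImageDelta`, `TwoTorsionGaloisActionProofs` (`delta`), `DivisionField`, `…AdditivePotGoodCubicHeart` (`AddKatoTwo.finrank_divisionField_two_dvd_six`),
g16 `…PadicLetterOnPointsPrimes` (`liesOver_span_of_natCast_mem`).
-/

set_option linter.dupNamespace false
set_option autoImplicit false

noncomputable section

open scoped Classical NumberField nonZeroDivisors

namespace Summit.BirchSwinnertonDyer.BirchSwinnertonDyer.Theorems.AlignedTransportAtTwoCubicClosureParity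

open NumberField IsDedekindDomain
  Summit.BirchSwinnertonDyer.BirchSwinnertonDyer.Theorems.AlignedTransportAtTwoCubicResolventParity

/-! ## §3 The `S₃`-closure: `[ℚ(δ) : ℚ] = 2` and the parity transfer down to `ℚ(β)` -/

section Closure

open Polynomial WeierstrassCurve IntermediateField Field
  Literature.NumberTheory.EllipticCurves Literature.NumberTheory.GaloisRepresentations
  Literature.NumberTheory.EllipticCurves.DokchitserDokchitser2012
  Summit.BirchSwinnertonDyer.BirchSwinnertonDyer.Theorems.AlignedTransportAtTwoFineRoad.DivisionCubic
  Summit.BirchSwinnertonDyer.BirchSwinnertonDyer.Theorems.AlignedTransportAtTwoFineRoad.TowerImageDelta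

/-- An integer square is `≡ 0, 1` or `4 (mod 8)`. [folklore] -/
theorem emod_eight_of_isSquare {D : ℤ} (h : IsSquare D) : D % 8 = 0 ∨ D % 8 = 1 ∨ D % 8 = 4 := by
  obtain ⟨r, rfl⟩ := h
  have hr : r % 8 = 0 ∨ r % 8 = 1 ∨ r % 8 = 2 ∨ r % 8 = 3 ∨ r % 8 = 4 ∨ r % 8 = 5 ∨ r % 8 = 6 ∨ r % 8 = 7 := by omega
  have key : r * r % 8 = (r % 8) * (r % 8) % 8 := Int.mul_emod r r 8
  rcases hr with h | h | h | h | h | h | h | h <;> rw [h] at key <;> omega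

/-- `[ℚ(δ) : ℚ] = 2` for `δ² = q`, `q` a rational non-square (`minpoly δ = X² − q`). [folklore] -/
theorem finrank_adjoin_eq_two_of_sq_eq {L : Type*} [Field L] [CharZero L] [Algebra ℚ L] {δ : L} {q : ℚ} (hδ : δ ^ 2 = (q : L))
    (hq : ¬ IsSquare q) : Module.finrank ℚ ℚ⟮δ⟯ = 2 := by
  have hδ' : δ ^ 2 = algebraMap ℚ L q := by rw [hδ, eq_ratCast]
  have hroot : aeval δ (X ^ 2 - C q : ℚ[X]) = 0 := by simp [hδ']
  have hmonic : (X ^ 2 - C q : ℚ[X]).Monic := monic_X_pow_sub_C q two_ne_zero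
  have hint : IsIntegral ℚ δ := ⟨_, hmonic, by simpa [eval₂_eq_eval_map] using hroot⟩
  rw [IntermediateField.adjoin.finrank hint]
  apply le_antisymm
  · have h := natDegree_le_of_dvd (minpoly.dvd ℚ δ hroot) hmonic.ne_zero
    rwa [natDegree_X_pow_sub_C] at h
  · rw [minpoly.two_le_natDegree_iff hint]
    rintro ⟨r, hr⟩
    apply hq
    refine ⟨r, ?_⟩
    apply (algebraMap ℚ L).injective
    rw [← hδ', ← hr, map_mul, sq]

variable (W : WeierstrassCurve ℚ) [W.IsElliptic]

/-- **PARITY TRANSFER DOWN TO `ℚ(β)`** (the kernel tool of this file). `W/ℚ` elliptic with `Δ_W` not a square, `δ, β ∈ ℚ̄` with `δ² = Δ_W`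
and `β` a root of the `2`-division cubic; `p` any prime. Inside `ℚ̄`, `T = ℚ(W[2]) ⊇ ℚ(β), ℚ(δ)` is Galois over `ℚ` of degree dividing
`6`, hence Galois of degree dividing `3` over the quadratic field `ℚ(δ)`; so (§1) every prime of `T` has odd `e`, `f` over `ℚ(δ)`, and:
if every prime of `ℚ(δ)` above `p` has ODD ramification index (resp. residue degree), then so does every prime of `ℚ(β)` above `p`.
[cite: NeukirchANT1999, Ch. I §8–§9] [cite: SilvermanAEC2009, VIII.§1] [cite: DokchitserDokchitserMathZ2012, Theorem (1), proof (ℚ(E[2]) ⊃ ℚ(√Δ))] -/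
theorem parity_transfer_adjoin_root (hΔ : ¬ IsSquare W.Δ) {δ β : AlgebraicClosure ℚ}
    (hδ : δ ^ 2 = ((W.Δ : ℚ) : AlgebraicClosure ℚ)) (hβ : aeval β W.twoTorsionPolynomial.toPoly = 0) (p : ℕ) :
    ((∀ Q : Ideal (𝓞 ℚ⟮δ⟯), Q.IsPrime → (p : 𝓞 ℚ⟮δ⟯) ∈ Q → Odd (Q.ramificationIdx ℤ)) →
        ∀ w : HeightOneSpectrum (𝓞 ℚ⟮β⟯), (p : 𝓞 ℚ⟮β⟯) ∈ w.asIdeal → Odd (w.asIdeal.ramificationIdx ℤ)) ∧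
      ((∀ Q : Ideal (𝓞 ℚ⟮δ⟯), Q.IsPrime → (p : 𝓞 ℚ⟮δ⟯) ∈ Q → Odd (Q.inertiaDeg ℤ)) →
        ∀ w : HeightOneSpectrum (𝓞 ℚ⟮β⟯), (p : 𝓞 ℚ⟮β⟯) ∈ w.asIdeal → Odd (w.asIdeal.inertiaDeg ℤ)) := by
  have h2 : (2 : ℚ) ≠ 0 := two_ne_zero
  -- the top field `T = ℚ(W[2])`
  haveI : NumberField (W.divisionField 2) := NumberField.mk
  haveI : IsGalois ℚ (W.divisionField 2) := W.isGalois_divisionField 2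
  -- `β ∈ T`, `δ ∈ T`
  have hβT : β ∈ W.divisionField 2 :=
    rootSet_subset_divisionField W h2 ((mem_rootSet_of_ne (twoTorsionPolynomial_toPoly_ne_zero W h2)).mpr hβ)
  have hδT : δ ∈ W.divisionField 2 := by
    have hd : delta W h2 ∈ W.divisionField 2 := by
      change (xT W h2 0 - xT W h2 1) * (xT W h2 0 - xT W h2 2) * (xT W h2 1 - xT W h2 2) ∈ W.divisionField 2
      exact mul_mem (mul_mem (sub_mem (xT_mem_divisionField W h2 0) (xT_mem_divisionField W h2 1))
        (sub_mem (xT_mem_divisionField W h2 0) (xT_mem_divisionField W h2 2)))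
        (sub_mem (xT_mem_divisionField W h2 1) (xT_mem_divisionField W h2 2))
    have hsq : δ ^ 2 = (4 * delta W h2) ^ 2 := by
      have h16 := sixteen_mul_delta_sq W h2
      rw [eq_ratCast] at h16
      rw [hδ, ← h16]; ring
    have h4 : (4 : AlgebraicClosure ℚ) ∈ W.divisionField 2 := ofNat_mem _ 4
    rcases sq_eq_sq_iff_eq_or_eq_neg.mp hsq with h | h
    · rw [h]; exact mul_mem h4 hd
    · rw [h]; exact neg_mem (mul_mem h4 hd)
  have hF : ℚ⟮β⟯ ≤ W.divisionField 2 := adjoin_simple_le_iff.mpr hβT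
  have hK : ℚ⟮δ⟯ ≤ W.divisionField 2 := adjoin_simple_le_iff.mpr hδT
  -- the two intermediate extensions `ℚ(β) ⊆ T`, `ℚ(δ) ⊆ T`
  letI algF : Algebra ℚ⟮β⟯ (W.divisionField 2) := (IntermediateField.inclusion hF).toRingHom.toAlgebra
  letI algK : Algebra ℚ⟮δ⟯ (W.divisionField 2) := (IntermediateField.inclusion hK).toRingHom.toAlgebra
  haveI : IsScalarTower ℚ ℚ⟮β⟯ (W.divisionField 2) :=
    IsScalarTower.of_algebraMap_eq fun q => ((IntermediateField.inclusion hF).commutes q).symm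
  haveI : IsScalarTower ℚ ℚ⟮δ⟯ (W.divisionField 2) :=
    IsScalarTower.of_algebraMap_eq fun q => ((IntermediateField.inclusion hK).commutes q).symm
  have hβint : IsIntegral ℚ β := ((AlgebraicClosure.isAlgebraic ℚ).isAlgebraic β).isIntegral
  have hδint : IsIntegral ℚ δ := ((AlgebraicClosure.isAlgebraic ℚ).isAlgebraic δ).isIntegral
  haveI : FiniteDimensional ℚ ℚ⟮β⟯ := IntermediateField.adjoin.finiteDimensional hβint
  haveI : FiniteDimensional ℚ ℚ⟮δ⟯ := IntermediateField.adjoin.finiteDimensional hδint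
  haveI : NumberField ℚ⟮β⟯ := NumberField.mk
  haveI : NumberField ℚ⟮δ⟯ := NumberField.mk
  haveI : IsGalois ℚ⟮δ⟯ (W.divisionField 2) := IsGalois.tower_top_of_isGalois ℚ ℚ⟮δ⟯ (W.divisionField 2)
  -- `[T : ℚ(δ)]` is odd: `2 · [T : ℚ(δ)] = [T : ℚ] ∣ 6`
  have hK2 : Module.finrank ℚ ℚ⟮δ⟯ = 2 :=
    finrank_adjoin_eq_two_of_sq_eq hδ hΔ
  have hodd : Odd (Module.finrank ℚ⟮δ⟯ (W.divisionField 2)) := by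
    have hmul := Module.finrank_mul_finrank ℚ ℚ⟮δ⟯ (W.divisionField 2)
    have h6 := AddKatoTwo.finrank_divisionField_two_dvd_six W
    rw [hK2] at hmul
    have h3 : Module.finrank ℚ⟮δ⟯ (W.divisionField 2) ∣ 3 := by
      have : 2 * Module.finrank ℚ⟮δ⟯ (W.divisionField 2) ∣ 2 * 3 := by rw [hmul]; exact h6
      exact Nat.dvd_of_mul_dvd_mul_left two_pos this
    exact Odd.of_dvd_nat (by decide : Odd 3) h3
  exact ⟨fun hKe => odd_ramificationIdx_of_odd_degree_galois (K₂ := ℚ⟮δ⟯) (T := W.divisionField 2) hodd hKe,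
    fun hKf => odd_inertiaDeg_of_odd_degree_galois (K₂ := ℚ⟮δ⟯) (T := W.divisionField 2) hodd hKf⟩

end Closure

/-! ## §4 The parity count `#{v ∣ p} ≡ [F : ℚ] (mod 2)` -/

section Count

variable {F : Type*} [Field F] [NumberField F]

/-- **Parity count.** If every prime of `F` above `p` has odd `e` and odd `f`, then the NUMBER of primes of `F` above `p` is congruent to
`[F : ℚ]` modulo `2` (fundamental identity `Σ eᵢfᵢ = [F : ℚ]` with every term odd). [cite: NeukirchANT1999, Ch. I §8, Prop. (8.2)] -/
theorem ncard_setOf_mem_mod_two_eq_finrank_mod_two {p : ℕ} (hp : p.Prime)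
    (he : ∀ w : HeightOneSpectrum (𝓞 F), (p : 𝓞 F) ∈ w.asIdeal → Odd (w.asIdeal.ramificationIdx ℤ))
    (hf : ∀ w : HeightOneSpectrum (𝓞 F), (p : 𝓞 F) ∈ w.asIdeal → Odd (w.asIdeal.inertiaDeg ℤ)) :
    {w : HeightOneSpectrum (𝓞 F) | (p : 𝓞 F) ∈ w.asIdeal}.ncard % 2 = Module.finrank ℚ F % 2 := by
  classical
  haveI : Fact p.Prime := ⟨hp⟩
  haveI : (Ideal.span {(p : ℤ)}).IsMaximal := Int.ideal_span_isMaximal_of_prime p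
  have hp0 : (Ideal.span {(p : ℤ)} : Ideal ℤ) ≠ ⊥ := by
    rw [Ne, Ideal.span_singleton_eq_bot]; exact_mod_cast hp.ne_zero
  set S := IsDedekindDomain.primesOverFinset (Ideal.span {(p : ℤ)}) (𝓞 F) with hSdef
  -- each `P ∈ S` is a height-one prime containing `p`, with `e'·f'` odd
  have hmemS : ∀ P ∈ S, ∃ w : HeightOneSpectrum (𝓞 F), (p : 𝓞 F) ∈ w.asIdeal ∧ w.asIdeal = P := by
    intro P hP
    obtain ⟨hPp, hPl⟩ := (IsDedekindDomain.mem_primesOverFinset_iff hp0 _).mp hP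
    have hP0 : P ≠ ⊥ := Ideal.ne_bot_of_liesOver_of_ne_bot hp0 P
    have hpP : (p : 𝓞 F) ∈ P := by
      have h := (Ideal.mem_of_liesOver P (Ideal.span {(p : ℤ)}) (p : ℤ)).mp (Ideal.mem_span_singleton_self _)
      simpa using h
    exact ⟨⟨P, hPp, hP0⟩, hpP, rfl⟩
  have hodd : ∀ P ∈ S, (Ideal.ramificationIdx' (Ideal.span {(p : ℤ)}) P * Ideal.inertiaDeg' (Ideal.span {(p : ℤ)}) P) % 2 = 1 := by
    intro P hP
    obtain ⟨w, hw, rfl⟩ := hmemS P hP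
    obtain ⟨hPp, hPl⟩ := (IsDedekindDomain.mem_primesOverFinset_iff hp0 _).mp hP
    haveI := hPl
    haveI : w.asIdeal.IsMaximal := w.isMaximal
    rw [Ideal.ramificationIdx'_eq_ramificationIdx (Ideal.span {(p : ℤ)}) w.asIdeal hp0,
      Ideal.inertiaDeg'_eq_inertiaDeg (Ideal.span {(p : ℤ)}) w.asIdeal]
    exact Nat.odd_iff.mp ((he w hw).mul (hf w hw))
  -- the set of primes above `p` is in bijection with `S`
  have hbij : (fun w : HeightOneSpectrum (𝓞 F) => w.asIdeal) '' {w : HeightOneSpectrum (𝓞 F) | (p : 𝓞 F) ∈ w.asIdeal} = ↑S := by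
    ext P
    constructor
    · rintro ⟨w, hw, rfl⟩
      haveI : w.asIdeal.IsPrime := w.isPrime
      exact (IsDedekindDomain.mem_primesOverFinset_iff hp0 _).mpr
        ⟨w.isPrime, AlignedTransportAtTwoFineRoad.RealKummerLinesPadicLetterOnPointsPrimes.liesOver_span_of_natCast_mem p w hw⟩
    · intro hP
      obtain ⟨w, hw, rfl⟩ := hmemS P hP
      exact ⟨w, hw, rfl⟩
  have hcard : {w : HeightOneSpectrum (𝓞 F) | (p : 𝓞 F) ∈ w.asIdeal}.ncard = S.card := by
    rw [← Set.ncard_coe_finset, ← hbij, Set.ncard_image_of_injective _ fun v w h => HeightOneSpectrum.ext h]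
  -- sum the fundamental identity modulo `2`
  have hsum := Ideal.sum_ramification_inertia (R := ℤ) (𝓞 F) ℚ F (p := Ideal.span {(p : ℤ)}) hp0
  rw [hcard, ← hsum, Finset.sum_nat_mod, Finset.sum_congr rfl hodd, ← Finset.card_eq_sum_ones]

/-- In a CUBIC field all of whose primes above `p` have odd `e` and odd `f`, the number of primes above `p` is ODD.
[cite: NeukirchANT1999, Ch. I §8, Prop. (8.2)] -/
theorem odd_ncard_setOf_mem_of_cubic (hF : Module.finrank ℚ F = 3) {p : ℕ} (hp : p.Prime)
    (he : ∀ w : HeightOneSpectrum (𝓞 F), (p : 𝓞 F) ∈ w.asIdeal → Odd (w.asIdeal.ramificationIdx ℤ))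
    (hf : ∀ w : HeightOneSpectrum (𝓞 F), (p : 𝓞 F) ∈ w.asIdeal → Odd (w.asIdeal.inertiaDeg ℤ)) :
    Odd {w : HeightOneSpectrum (𝓞 F) | (p : 𝓞 F) ∈ w.asIdeal}.ncard := by
  rw [Nat.odd_iff, ncard_setOf_mem_mod_two_eq_finrank_mod_two hp he hf, hF]

end Count


end Summit.BirchSwinnertonDyer.BirchSwinnertonDyer.Theorems.AlignedTransportAtTwoCubicClosureParity

end
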